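import Summits.MatrixMultiplication.MatrixMultiplication.Theorems.OutsiderSandwichCancellingPair
import Summits.MatrixMultiplication.MatrixMultiplication.Theorems.OutsiderSandwichBlockOne
import HarnessLib

/-!
# The pair sandwich: `P_{2^N} ≤ C₁^{⊠N} ≤ 2^{N-1} · P_{2^N}` — level-`N` coupled blocks are pair tensors

Route `OutsiderSandwich` (decomposition cell `decomp-mm`, lens 4 «minimal counterexample /
extremal reduction», gen 30), support for the aside leaf `BlockOneIsMM`
(stmt-MatrixMultiplication-27147: `θ⋆ = 0`, i.e. `F⟨2,2,2⟩ ≤ F(C₁)` at every universal spectral point).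

The coupled block is the PAIR TENSOR `C₁ ≅ P₂`, `P_n = [(A; u, w) ↦ (A u, Aᵀ w)]`
(`OutsiderSandwichBlockNormalForm.pairTensor`).  This file computes the Kronecker products of pair
tensors: with `𝐗 = A ⊗ A'` an `(ρ × σ)`-indexed square matrix, `P_ρ ⊠ P_σ` is the FOUR-SLOT tensor
`(𝐗; y_a, y_b, y_c, y_d) ↦ (𝐗 y_a, 𝐗^{T₂} y_b, 𝐗^{T₁} y_c, 𝐗ᵀ y_d)` (`T₁, T₂` the partial
transposes), hence

* `kronecker_restrictsTo_pairOn_prod` — **`P_ρ ⊠ P_σ ≥ P_{ρ×σ}`** (keep the slots `a, d`);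
* `directSum_restrictsTo_kronecker` — **`P_{ρ×σ} ⊕ P_{ρ×σ} ≥ P_ρ ⊠ P_σ`** (feed `𝐗` to the first
  copy and `𝐗^{T₂}` to the second: slots `a, d` come from the first, `b, c` from the second copy);
* `sandwich`, `sandwich_two` — in the tensor semiring `T(ℂ)`:
  **`[P_{2^N}] ≤ [C₁]^N ≤ 2^{N-1} · [P_{2^N}]`** for `N ≥ 1` (`[P₄] ≤ [C₁]² ≤ 2·[P₄]`), and at every
  universal spectral point `F(P_{2^N}) ≤ F(C₁)^N ≤ 2^{N-1} · F(P_{2^N})` (`map_sandwich`,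
  `map_sandwich_two`);
* `blockOneIsMM_pair_reading`, `pair_reading_of_summit` — under the leaf (in particular if
  `ω = 2`), `F⟨2,2,2⟩^N ≤ 2^{N-1} · F(P_{2^N})` for all `N ≥ 1`.

Reading for the amortised border table (`OutsiderSandwichBorderTable`): every level-`N` certificate
`⟨B⟩ ⊠ C₁^{⊠N} ⊵ ⟨m⟩ ⊠ ⟨2,2,2⟩^{⊠N}` is a certificate for `2^{N-1}` copies of the single pair tensor
`P_{2^N}`, and the slice-rank floor `B·(4^N − 2^{N-1}) ≥ m·4^N` (`OutsiderSandwichBorderFloor`) is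
exactly the input-slice rank `2^{N-1}·(2·2^N − 1)` of the upper bound `2^{N-1}·P_{2^N}` (the one linear
relation `⟨w, A u⟩ = ⟨u, Aᵀ w⟩` per pair tensor).  The factor `2^{N-1}` is the only place where the
coupling `A' = A^{T₂}` between the two halves of `C₁^{⊠N}` enters.

## References
* D. Coppersmith, S. Winograd, *Matrix multiplication via arithmetic progressions*,
  J. Symbolic Comput. 9 (1990) 251–280, §7 (the coupled term `T^{[211]}`). [CoppersmithWinograd1990]
* P. Bürgisser, M. Clausen, M. A. Shokrollahi, *Algebraic Complexity Theory*, Springer 1997,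
  §14.6 (restriction by substitution), (14.23) (direct sums). [BurgisserClausenShokrollahi1997]
* J. Zuiddam, *Algebraic complexity, asymptotic spectra and entanglement polytopes*, PhD thesis,
  Amsterdam 2018, §2.3 (the semiring `T(K)`). [Zuiddam2018]
-/

noncomputable section

set_option linter.dupNamespace false
set_option autoImplicit false

namespace Summit.MatrixMultiplication.MatrixMultiplication.Theorems.OutsiderSandwichPairSandwich

open Literature.Computability.AlgebraicComplexity
open Summit.MatrixMultiplication.MatrixMultiplication.Theorems.OutsiderSandwichCoupling (coupling₁)
open Summit.MatrixMultiplication.MatrixMultiplication.Theorems.OutsiderSandwichBlockNormalForm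
  (pairTensor pairTensor_restrictsTo_coupling₁ coupling₁_restrictsTo_pairTensor)

variable {ρ σ : Type} [DecidableEq ρ] [DecidableEq σ]

/-! ## 1. Pair tensors on an arbitrary index type -/

/-- The pair tensor `P_ρ = [(A; u, w) ↦ (A u, Aᵀ w)]` with rows and columns indexed by `ρ`
(`pairOn (Fin n) = pairTensor n` definitionally). [new] -/
def pairOn (ρ : Type) [DecidableEq ρ] : ρ × ρ → Fin 2 × ρ → Fin 2 × ρ → ℂ :=
  fun a y z =>
    if (y.1 = 0 ∧ z.1 = 1 ∧ y.2 = a.2 ∧ z.2 = a.1) ∨ (y.1 = 1 ∧ z.1 = 0 ∧ y.2 = a.1 ∧ z.2 = a.2)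
    then 1 else 0

/-- `pairOn (Fin n)` is the tree's `pairTensor n`. [folklore] -/
theorem pairOn_fin (n : ℕ) : pairOn (Fin n) = pairTensor n := rfl

/-- Relabelling rows and columns along a bijection pulls `P_σ` back to `P_ρ`. [folklore] -/
theorem pairOn_reindex (e : ρ ≃ σ) :
    (fun a y z => pairOn σ (Equiv.prodCongr e e a) (Equiv.prodCongr (Equiv.refl _) e y)
      (Equiv.prodCongr (Equiv.refl _) e z)) = pairOn ρ := by
  funext a y z
  simp only [pairOn, Equiv.prodCongr_apply, Equiv.coe_refl, Prod.map_fst, Prod.map_snd, id_eq,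
    e.apply_eq_iff_eq]

/-- The class of `P_ρ` in `T(ℂ)` depends only on `|ρ|`. [folklore] -/
theorem mk_pairOn_congr [Fintype ρ] [Fintype σ] (e : ρ ≃ σ) :
    TensorClass.mk (pairOn ρ) = TensorClass.mk (pairOn σ) := by
  rw [← pairOn_reindex e, TensorClass.mk_reindex]

/-! ## 2. `P_ρ ⊠ P_σ ≥ P_{ρ×σ}`: keep the untwisted and the fully transposed slot -/

/-- `x`-leg index map: the entry `((r₁,r₂),(c₁,c₂))` of `𝐗 = A ⊗ A'` is `A_{r₁c₁} A'_{r₂c₂}`. [new] -/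
def fX (a : (ρ × σ) × (ρ × σ)) : (ρ × ρ) × (σ × σ) := ((a.1.1, a.2.1), (a.1.2, a.2.2))

/-- `y`-leg index map: slot `a = u ⊗ u'` (half `0`) and slot `d = w ⊗ w'` (half `1`). [new] -/
def fY (y : Fin 2 × (ρ × σ)) : (Fin 2 × ρ) × (Fin 2 × σ) := ((y.1, y.2.1), (y.1, y.2.2))

/-- **`P_{ρ×σ}` is the `(a, d)`-slot part of `P_ρ ⊠ P_σ`** (an identity of `0/1` tables). [new] -/
theorem pairOn_prod_eq :
    pairOn (ρ × σ) = fun a y z => kroneckerTensor (pairOn ρ) (pairOn σ) (fX a) (fY y) (fY z) := by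
  funext a y z
  obtain ⟨⟨r₁, r₂⟩, ⟨c₁, c₂⟩⟩ := a
  obtain ⟨hy, ⟨j₁, j₂⟩⟩ := y
  obtain ⟨hz, ⟨i₁, i₂⟩⟩ := z
  simp only [pairOn, kroneckerTensor_apply, fX, fY, Prod.mk.injEq, ite_zero_mul_ite_zero, one_mul]
  by_cases h : (hy = 0 ∧ hz = 1 ∧ (j₁ = c₁ ∧ j₂ = c₂) ∧ i₁ = r₁ ∧ i₂ = r₂) ∨
      (hy = 1 ∧ hz = 0 ∧ (j₁ = r₁ ∧ j₂ = r₂) ∧ i₁ = c₁ ∧ i₂ = c₂)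
  · rw [if_pos h, if_pos]
    rcases h with ⟨h1, h2, ⟨h3, h4⟩, h5, h6⟩ | ⟨h1, h2, ⟨h3, h4⟩, h5, h6⟩
    · exact ⟨Or.inl ⟨h1, h2, h3, h5⟩, Or.inl ⟨h1, h2, h4, h6⟩⟩
    · exact ⟨Or.inr ⟨h1, h2, h3, h5⟩, Or.inr ⟨h1, h2, h4, h6⟩⟩
  · rw [if_neg h, if_neg]
    rintro ⟨⟨h1, h2, h3, h5⟩ | ⟨h1, h2, h3, h5⟩, ⟨h1', h2', h4, h6⟩ | ⟨h1', h2', h4, h6⟩⟩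
    · exact h (Or.inl ⟨h1, h2, ⟨h3, h4⟩, h5, h6⟩)
    · rw [h1] at h1'; exact absurd h1' (by decide)
    · rw [h1] at h1'; exact absurd h1' (by decide)
    · exact h (Or.inr ⟨h1, h2, ⟨h3, h4⟩, h5, h6⟩)

/-- **`P_ρ ⊠ P_σ ≥ P_{ρ×σ}`** (zero out the two mixed slots). [new] -/
theorem kronecker_restrictsTo_pairOn_prod [Fintype ρ] [Fintype σ] :
    TensorRestrictsTo (kroneckerTensor (pairOn ρ) (pairOn σ)) (pairOn (ρ × σ)) := by
  rw [pairOn_prod_eq (ρ := ρ) (σ := σ)]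
  exact tensorRestrictsTo_precomp _ _ _ _

/-! ## 3. `P_{ρ×σ} ⊕ P_{ρ×σ} ≥ P_ρ ⊠ P_σ`: the second copy carries `𝐗^{T₂}` -/

/-- **Restriction along a two-branch relabelling**: `t ≥ (t (f₁ a) (g b) (h c) + t (f₂ a) (g b) (h c))`
(the `x`-matrix is the sum of the two `0/1` relabelling matrices; Bläser 2013, Def. 7.2).
[cite: Blaser2013, Def. 7.2] -/
theorem tensorRestrictsTo_precomp_add {K : Type} [Field K] {ι κ μ ι' κ' μ' : Type} [Fintype ι]
    [Fintype κ] [Fintype μ] [DecidableEq ι] [DecidableEq κ] [DecidableEq μ] (t : ι → κ → μ → K)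
    (f₁ f₂ : ι' → ι) (g : κ' → κ) (h : μ' → μ) :
    TensorRestrictsTo t (fun a b c => t (f₁ a) (g b) (h c) + t (f₂ a) (g b) (h c)) := by
  refine ⟨fun a' a => (if f₁ a' = a then 1 else 0) + (if f₂ a' = a then 1 else 0),
    fun b' b => if g b' = b then 1 else 0, fun c' c => if h c' = c then 1 else 0,
    fun a' b' c' => ?_⟩
  have hsum : ∀ (f : ι' → ι), (∑ a, ∑ b, ∑ c, (if f a' = a then (1 : K) else 0) *
      (if g b' = b then 1 else 0) * (if h c' = c then 1 else 0) * t a b c) =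
        t (f a') (g b') (h c') := by
    intro f
    rw [Finset.sum_eq_single (f a') (fun a _ ha => by simp [Ne.symm ha]) (by simp),
      Finset.sum_eq_single (g b') (fun b _ hb => by simp [Ne.symm hb]) (by simp),
      Finset.sum_eq_single (h c') (fun c _ hc => by simp [Ne.symm hc]) (by simp)]
    simp
  simp only [add_mul, Finset.sum_add_distrib]
  rw [hsum f₁, hsum f₂]

/-- first `x`-branch: `𝐗 = A ⊗ A'` itself, row `(r₁,r₂)`, column `(c₁,c₂)`. [new] -/
def untw (a : (ρ × ρ) × (σ × σ)) : (ρ × σ) × (ρ × σ) := ((a.1.1, a.2.1), (a.1.2, a.2.2))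

/-- second `x`-branch: the partial transpose `𝐗^{T₂} = A ⊗ A'ᵀ`, row `(r₁,c₂)`, column `(c₁,r₂)`.
[new] -/
def tw (a : (ρ × ρ) × (σ × σ)) : (ρ × σ) × (ρ × σ) := ((a.1.1, a.2.2), (a.1.2, a.2.1))

/-- slot map on the vector / output legs: equal halves (slots `a, d`; outputs of `a, d`) go to the
first copy, unequal halves (slots `b, c`) to the second; the half kept is the first factor's. [new] -/
def gS (y : (Fin 2 × ρ) × (Fin 2 × σ)) : (Fin 2 × (ρ × σ)) ⊕ (Fin 2 × (ρ × σ)) :=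
  if y.1.1 = y.2.1 then Sum.inl (y.1.1, (y.1.2, y.2.2)) else Sum.inr (y.1.1, (y.1.2, y.2.2))

/-- **The four-slot identity**: `P_ρ ⊠ P_σ = (P ⊕ P)(untw ·) + (P ⊕ P)(tw ·)` along `gS`,
`P = P_{ρ×σ}` (slots `a, d` read `𝐗`, slots `b, c` read `𝐗^{T₂}`; `0/1` tables). [new] -/
theorem kronecker_eq_two_branch :
    kroneckerTensor (pairOn ρ) (pairOn σ) = fun a y z =>
      directSumTensor (pairOn (ρ × σ)) (pairOn (ρ × σ)) (Sum.inl (untw a)) (gS y) (gS z) +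
        directSumTensor (pairOn (ρ × σ)) (pairOn (ρ × σ)) (Sum.inr (tw a)) (gS y) (gS z) := by
  funext a y z
  obtain ⟨⟨r₁, c₁⟩, ⟨r₂, c₂⟩⟩ := a
  obtain ⟨⟨hy₁, j₁⟩, ⟨hy₂, j₂⟩⟩ := y
  obtain ⟨⟨hz₁, i₁⟩, ⟨hz₂, i₂⟩⟩ := z
  simp only [kroneckerTensor_apply, gS, untw, tw]
  -- sixteen half-patterns
  rcases Fin.exists_fin_two.mp ⟨hy₁, rfl⟩ with e₁ | e₁ <;>
  rcases Fin.exists_fin_two.mp ⟨hy₂, rfl⟩ with e₂ | e₂ <;>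
  rcases Fin.exists_fin_two.mp ⟨hz₁, rfl⟩ with e₃ | e₃ <;>
  rcases Fin.exists_fin_two.mp ⟨hz₂, rfl⟩ with e₄ | e₄ <;>
  simp only [e₁, e₂, e₃, e₄, pairOn, directSumTensor, Prod.mk.injEq, one_ne_zero, zero_ne_one,
    true_and, false_and,
    and_false, or_false, false_or, if_true, if_false, mul_ite, mul_one,
    mul_zero, add_zero, zero_add] <;>
  first
  | rfl
  | (split_ifs <;> first | rfl | (exfalso; tauto))

/-- **`P_{ρ×σ} ⊕ P_{ρ×σ} ≥ P_ρ ⊠ P_σ`**. [new] -/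
theorem directSum_restrictsTo_kronecker [Fintype ρ] [Fintype σ] :
    TensorRestrictsTo (directSumTensor (pairOn (ρ × σ)) (pairOn (ρ × σ)))
      (kroneckerTensor (pairOn ρ) (pairOn σ)) := by
  rw [kronecker_eq_two_branch (ρ := ρ) (σ := σ)]
  exact tensorRestrictsTo_precomp_add _ (fun a => Sum.inl (untw a)) (fun a => Sum.inr (tw a)) gS gS

/-! ## 4. The sandwich in the tensor semiring `T(ℂ)` -/

section Semiring

variable [Fintype ρ] [Fintype σ]

/-- `[P_{ρ×σ}] ≤ [P_ρ]·[P_σ]`. [new] -/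
theorem mk_pairOn_prod_le :
    TensorClass.mk (pairOn (ρ × σ)) ≤ TensorClass.mk (pairOn ρ) * TensorClass.mk (pairOn σ) := by
  rw [TensorClass.mk_mul_mk, TensorClass.mk_le_mk_iff]
  exact kronecker_restrictsTo_pairOn_prod

/-- `[P_ρ]·[P_σ] ≤ 2·[P_{ρ×σ}]`. [new] -/
theorem mk_mul_le_two_mul :
    TensorClass.mk (pairOn ρ) * TensorClass.mk (pairOn σ) ≤ 2 * TensorClass.mk (pairOn (ρ × σ)) := by
  rw [two_mul, TensorClass.mk_mul_mk, TensorClass.mk_add_mk, TensorClass.mk_le_mk_iff]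
  exact directSum_restrictsTo_kronecker

end Semiring

/-- `[C₁] = [P_{Fin 2}]` (the g17 normal form `C₁ ≅ pairTensor 2`). [folklore] -/
theorem mk_coupling₁_eq : TensorClass.mk coupling₁ = TensorClass.mk (pairOn (Fin 2)) :=
  TensorClass.mk_eq_mk pairTensor_restrictsTo_coupling₁ coupling₁_restrictsTo_pairTensor

/-- `[P_{Fin 2^N × Fin 2}] = [P_{2^{N+1}}]`. [folklore] -/
theorem mk_pairOn_succ (N : ℕ) :
    TensorClass.mk (pairOn (Fin (2 ^ N) × Fin 2)) = TensorClass.mk (pairTensor (2 ^ (N + 1))) := by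
  rw [← pairOn_fin]
  exact mk_pairOn_congr (finProdFinEquiv.trans (finCongr (pow_succ 2 N).symm))

/-- **The pair sandwich** in `T(ℂ)`: `[P_{2^{N+1}}] ≤ [C₁]^{N+1} ≤ 2^N · [P_{2^{N+1}}]`. [new] -/
theorem sandwich (N : ℕ) :
    TensorClass.mk (pairTensor (2 ^ (N + 1))) ≤ TensorClass.mk coupling₁ ^ (N + 1) ∧
      TensorClass.mk coupling₁ ^ (N + 1) ≤
        (2 : TensorClass ℂ) ^ N * TensorClass.mk (pairTensor (2 ^ (N + 1))) := by
  induction N with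
  | zero =>
    simp only [zero_add, pow_one, pow_zero, one_mul, mk_coupling₁_eq, pairOn_fin]
    exact ⟨le_rfl, le_rfl⟩
  | succ N ih =>
    obtain ⟨lo, hi⟩ := ih
    refine ⟨?_, ?_⟩
    · calc TensorClass.mk (pairTensor (2 ^ (N + 1 + 1)))
          = TensorClass.mk (pairOn (Fin (2 ^ (N + 1)) × Fin 2)) := (mk_pairOn_succ (N + 1)).symm
        _ ≤ TensorClass.mk (pairOn (Fin (2 ^ (N + 1)))) * TensorClass.mk (pairOn (Fin 2)) :=
          mk_pairOn_prod_le
        _ = TensorClass.mk (pairTensor (2 ^ (N + 1))) * TensorClass.mk coupling₁ := by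
          rw [pairOn_fin, mk_coupling₁_eq]
        _ ≤ TensorClass.mk coupling₁ ^ (N + 1) * TensorClass.mk coupling₁ :=
          TensorClass.mul_le_mul lo le_rfl
        _ = TensorClass.mk coupling₁ ^ (N + 1 + 1) := (pow_succ _ _).symm
    · calc TensorClass.mk coupling₁ ^ (N + 1 + 1)
          = TensorClass.mk coupling₁ ^ (N + 1) * TensorClass.mk coupling₁ := pow_succ _ _
        _ ≤ ((2 : TensorClass ℂ) ^ N * TensorClass.mk (pairTensor (2 ^ (N + 1)))) *
              TensorClass.mk coupling₁ := TensorClass.mul_le_mul hi le_rfl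
        _ = (2 : TensorClass ℂ) ^ N *
              (TensorClass.mk (pairOn (Fin (2 ^ (N + 1)))) * TensorClass.mk (pairOn (Fin 2))) := by
          rw [mk_coupling₁_eq, mul_assoc]; rfl
        _ ≤ (2 : TensorClass ℂ) ^ N * (2 * TensorClass.mk (pairOn (Fin (2 ^ (N + 1)) × Fin 2))) :=
          TensorClass.mul_le_mul le_rfl mk_mul_le_two_mul
        _ = (2 : TensorClass ℂ) ^ (N + 1) * TensorClass.mk (pairTensor (2 ^ (N + 1 + 1))) := by
          rw [mk_pairOn_succ, ← mul_assoc, ← pow_succ]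

/-- Level two: `[P₄] ≤ [C₁]² ≤ 2·[P₄]`. [new] -/
theorem sandwich_two :
    TensorClass.mk (pairTensor 4) ≤ TensorClass.mk coupling₁ ^ 2 ∧
      TensorClass.mk coupling₁ ^ 2 ≤ 2 * TensorClass.mk (pairTensor 4) := by
  simpa using sandwich 1

/-! ## 5. On the asymptotic spectrum -/

/-- **`F(P_{2^{N+1}}) ≤ F(C₁)^{N+1} ≤ 2^N · F(P_{2^{N+1}})`** at every universal spectral point. [new] -/
theorem map_sandwich {F : SpectralMap ℂ} (hF : IsUniversalSpectralPoint ℂ F) (N : ℕ) :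
    F (pairTensor (2 ^ (N + 1))) ≤ F coupling₁ ^ (N + 1) ∧
      F coupling₁ ^ (N + 1) ≤ 2 ^ N * F (pairTensor (2 ^ (N + 1))) := by
  obtain ⟨lo, hi⟩ := sandwich N
  have h₁ := TensorClass.evalRingHom_monotone hF lo
  have h₂ := TensorClass.evalRingHom_monotone hF hi
  simp only [map_pow, map_mul, map_ofNat, TensorClass.evalRingHom_mk] at h₁ h₂
  exact ⟨h₁, h₂⟩

/-- Level two on the spectrum: `F(P₄) ≤ F(C₁)² ≤ 2·F(P₄)`. [new] -/
theorem map_sandwich_two {F : SpectralMap ℂ} (hF : IsUniversalSpectralPoint ℂ F) :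
    F (pairTensor 4) ≤ F coupling₁ ^ 2 ∧ F coupling₁ ^ 2 ≤ 2 * F (pairTensor 4) := by
  simpa using map_sandwich hF 1

/-- **Pair reading of the leaf**: under `BlockOneIsMM` (`F⟨2,2,2⟩ ≤ F(C₁)`), the single pair tensor
`P_{2^{N+1}} = [(A; u, w) ↦ (A u, Aᵀ w)]` on `2^{N+1} × 2^{N+1}` matrices satisfies
`F⟨2,2,2⟩^{N+1} ≤ 2^N · F(P_{2^{N+1}})` at every universal spectral point. [new] -/
theorem blockOneIsMM_pair_reading (h : Theses.OutsiderSandwich.BlockOneIsMM) {F : SpectralMap ℂ}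
    (hF : IsUniversalSpectralPoint ℂ F) (N : ℕ) :
    F (matMulTensor ℂ 2 2 2) ^ (N + 1) ≤ 2 ^ N * F (pairTensor (2 ^ (N + 1))) := by
  have hle : F (matMulTensor ℂ 2 2 2) ≤ F coupling₁ := h F hF
  exact (pow_le_pow_left₀ (hF.nonneg _) hle _).trans (map_sandwich hF N).2

/-- The necessity direction made unconditional: **`ω = 2 ⟹ F⟨2,2,2⟩^{N+1} ≤ 2^N · F(P_{2^{N+1}})`**
for every universal spectral point (through `blockOneIsMM_of_summit`). [new] -/
theorem pair_reading_of_summit (hS : _root_.MatrixMultiplication) {F : SpectralMap ℂ}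
    (hF : IsUniversalSpectralPoint ℂ F) (N : ℕ) :
    F (matMulTensor ℂ 2 2 2) ^ (N + 1) ≤ 2 ^ N * F (pairTensor (2 ^ (N + 1))) :=
  blockOneIsMM_pair_reading (OutsiderSandwichBlockOne.blockOneIsMM_of_summit hS) hF N

end Summit.MatrixMultiplication.MatrixMultiplication.Theorems.OutsiderSandwichPairSandwich
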